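import Literature.AlgebraicGeometry.ModuliOfAbelianVarieties.SiegelRationalModelHeckeAction
import Literature.AlgebraicGeometry.Motives.FiniteQuotientQuasiProjective
import Literature.AlgebraicGeometry.Motives.FiniteQuotientDescendMorphism
import Literature.AlgebraicGeometry.HodgeTheory.HodgeGenericQbarDescentProofs
import HarnessLib

/-!
# The finite Hecke quotient of the base-changed Siegel `ℚ`-model as a RECEPTACLE: stable affine covers, separatedness,
# invertibility of `|Δ|`, and the base change `E ⊂ ℂ` of the quotient (step D4 of the I-1′ receptacle plan, opaque-action form)

Topic `AlgebraicGeometry/ModuliOfAbelianVarieties`; namespace `Literature.AlgebraicGeometry.ModuliOfAbelianVarieties`, decls under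
`SiegelRationalModel.`.  THEOREMS ONLY (no definition, no named fact, no instance).  Cell `hodgecm-mathlib` (D-0151), crux `HDel`
(item stmt-HodgeConjecture-24835), T3 `stub_Squot` — B-p01's (Squot lead) carve «D4-APP» (2026-08-28T16:24:28Z, refined 16:40:30Z to
OPAQUE actions), text of record: for a Siegel rational model `R` ([Milne2005ShimuraVarieties] Thm. 13.6), a principal level `KN`, a
number field `E ⊂ ℂ`, put `Z_E := (R.Nm KN) ⊗_ℚ E`, `Z := Z_E ⊗_E ℂ`, and let a finite group `Δ` act on `Z_E` by `E`-automorphisms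
(`actZE`) and on `Z` compatibly (`actZ d = (actZE d) ⊗_E ℂ`, hypothesis `hZ`; in the closer: the integral Hecke action of
`SiegelRationalModel.exists_heckeAction` composed with the twisted level homomorphism, descended to `Δ = Γ/(K_V × L_V)` and transported —
§4 records that instantiation, `actZE := (bc ℚ E).mapAut ∘ ρ₀`, `actZ := (bc E ℂ).mapAut ∘ actZE`, where `hZ` holds by `rfl`).  Then:
(i) every point of `Z_E` / `Z` lies in a `Δ`-stable affine open (quasi-projectivity of the Siegel model, [SGA1 V Prop. 1.8]); (ii) `Z_E`,
`Z` are separated; (iii) `|Δ|` is invertible in `E` and in `ℂ`; (iv) the finite quotient `A := Z_E/Δ` (the tree's `Motives.finiteQuotient`)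
is separated and its base change to `ℂ` IS the quotient of `Z`: `∃ i : A ⊗_E ℂ ≅ Z/Δ` with `(mk_E) ⊗ ℂ ≫ i = mk_ℂ` — packaged as
`exists_receptacle_finiteQuotient` (its two `IsSeparated` instance binders are (ii): the consumer writes
`haveI := SiegelRationalModel.isSeparated_baseChange_hom R KN E; haveI := SiegelRationalModel.isSeparated_baseChange_baseChange_hom R KN E`).
Everything is an application of the tree's finite-quotient theory (B-p06's Q5 `isSepQuotient_finiteQuotientMk_of_isQuasiProjectiveOver` /
`isSepQuotient_baseChangeHom_of_isQuasiProjectiveOver` / `isoFiniteQuotient_of_isSepQuotient_of_cover`, `IsQuasiProjectiveOver.baseChangeHom`).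
HC_CM is proved only modulo the 7 printed citations until rung 0 closes; nothing printed is asserted here.

## References
* [SGA1] A. Grothendieck, SGA 1, Exp. V, Prop. 1.8 and Prop. 1.9 (quotient by a finite group of a quasi-projective scheme; base change).
* [MumfordAV1970] D. Mumford, *Abelian Varieties* (1970), §7 Thm. p. 66 and Remark p. 69.
* [Deligne1971TravauxShimura] P. Deligne, *Travaux de Shimura* (1971), Déf. 3.1 p. 136, (5.11.1); [Milne2005ShimuraVarieties] Thm. 13.6.
-/

noncomputable section

open CategoryTheory CategoryTheory.Limits AlgebraicGeometry
open Literature.AlgebraicGeometry.Motives Literature.AlgebraicGeometry.HodgeTheory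
open Literature.AlgebraicGeometry.RelativeSpec

namespace Literature.AlgebraicGeometry.ModuliOfAbelianVarieties

namespace SiegelRationalModel

variable {g : ℕ} {δ : Fin g → ℕ} {Sg : SiegelComplexRecordSystem g δ} (R : SiegelRationalModel g δ Sg)
  (KN : SiegelLevel δ) (E : IntermediateField ℚ ℂ) (Δ : Type) [Group Δ] [Finite Δ]
  (actZE : Δ →* Aut ((Motives.baseChange ℚ ↥E).obj (R.Nm.obj KN))) (actZ : Δ →* Aut ((Motives.baseChange ↥E ℂ).obj ((Motives.baseChange ℚ ↥E).obj (R.Nm.obj KN))))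

/-! ## §1 Quasi-projectivity, separatedness, stable affine covers -/

/-- `Z_E = (R.Nm KN) ⊗_ℚ E` is quasi-projective over `E` (base change of the quasi-projective Siegel model, `R.quasiProjective`;
`IsQuasiProjectiveOver.baseChangeHom`). [cite: Milne2005ShimuraVarieties, Thm. 13.6] -/
theorem isQuasiProjectiveOver_baseChange : IsQuasiProjectiveOver ((Motives.baseChange ℚ ↥E).obj (R.Nm.obj KN)) :=
  IsQuasiProjectiveOver.baseChangeHom (algebraMap ℚ ↥E) (R.quasiProjective KN)

/-- `Z = Z_E ⊗_E ℂ` is quasi-projective over `ℂ`. [cite: Milne2005ShimuraVarieties, Thm. 13.6] -/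
theorem isQuasiProjectiveOver_baseChange_baseChange : IsQuasiProjectiveOver ((Motives.baseChange ↥E ℂ).obj ((Motives.baseChange ℚ ↥E).obj (R.Nm.obj KN))) :=
  IsQuasiProjectiveOver.baseChangeHom (algebraMap ↥E ℂ) (isQuasiProjectiveOver_baseChange R KN E)

/-- (ii) `Z_E` is separated over `E` (quasi-projective ⇒ separated; the standing hypothesis of [SGA1 V Prop. 1.8] / Mumford §7).
[cite: MumfordAV1970, §7 Remark p. 69] [cite: SGA1, Exp. V, Prop. 1.8] -/
theorem isSeparated_baseChange_hom : IsSeparated ((Motives.baseChange ℚ ↥E).obj (R.Nm.obj KN)).hom :=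
  isSeparated_hom_of_isQuasiProjectiveOver (isQuasiProjectiveOver_baseChange R KN E)

/-- (ii) `Z` is separated over `ℂ` (quasi-projective ⇒ separated). [cite: MumfordAV1970, §7 Remark p. 69] [cite: SGA1, Exp. V, Prop. 1.8] -/
theorem isSeparated_baseChange_baseChange_hom : IsSeparated ((Motives.baseChange ↥E ℂ).obj ((Motives.baseChange ℚ ↥E).obj (R.Nm.obj KN))).hom :=
  isSeparated_hom_of_isQuasiProjectiveOver (isQuasiProjectiveOver_baseChange_baseChange R KN E)

/-- (i) every point of `Z_E` lies in a `Δ`-stable affine open, for ANY action `actZE` of the finite group `Δ` by `E`-automorphisms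
([SGA1 V Prop. 1.8]: the scheme is quasi-projective; `ActionOver.forall_exists_stableAffineOpen_of_isQuasiProjectiveOver`).
[cite: SGA1, Exp. V, Prop. 1.8] [cite: MumfordAV1970, §7 Remark p. 69] -/
theorem forall_exists_stableAffineOpen_baseChange :
    ∀ z : ((Motives.baseChange ℚ ↥E).obj (R.Nm.obj KN)).left, ∃ O : (⟨((Over.forget _).mapAut ((Motives.baseChange ℚ ↥E).obj (R.Nm.obj KN))).comp actZE, fun d => Over.w (actZE d).hom⟩ : ActionOver ((Motives.baseChange ℚ ↥E).obj (R.Nm.obj KN)).hom Δ).StableAffineOpens, z ∈ O.1 :=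
  ActionOver.forall_exists_stableAffineOpen_of_isQuasiProjectiveOver _ (isQuasiProjectiveOver_baseChange R KN E)

/-- (i) every point of `Z` lies in a `Δ`-stable affine open, for ANY action `actZ` by `ℂ`-automorphisms. [cite: SGA1, Exp. V, Prop. 1.8]
[cite: MumfordAV1970, §7 Remark p. 69] -/
theorem forall_exists_stableAffineOpen_baseChange_baseChange :
    ∀ z : ((Motives.baseChange ↥E ℂ).obj ((Motives.baseChange ℚ ↥E).obj (R.Nm.obj KN))).left, ∃ O : (⟨((Over.forget _).mapAut ((Motives.baseChange ↥E ℂ).obj ((Motives.baseChange ℚ ↥E).obj (R.Nm.obj KN)))).comp actZ, fun d => Over.w (actZ d).hom⟩ : ActionOver ((Motives.baseChange ↥E ℂ).obj ((Motives.baseChange ℚ ↥E).obj (R.Nm.obj KN))).hom Δ).StableAffineOpens, z ∈ O.1 :=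
  ActionOver.forall_exists_stableAffineOpen_of_isQuasiProjectiveOver _ (isQuasiProjectiveOver_baseChange_baseChange R KN E)

/-! ## §2 `|Δ|` is invertible (characteristic zero) -/

omit [Group Δ] in
/-- (iii) `|Δ| ≠ 0` in `ℂ` — the characteristic hypothesis «char ∤ |G|» of Mumford's quotient theorem, automatic in characteristic `0`.
[cite: MumfordAV1970, §7 Thm. p. 66] -/
theorem natCard_ne_zero_complex [Nonempty Δ] : (Nat.card Δ : ℂ) ≠ 0 :=
  Nat.cast_ne_zero.2 Nat.card_pos.ne'

omit [Group Δ] in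
/-- (iii) `|Δ| ≠ 0` in `E` (characteristic `0`). [cite: MumfordAV1970, §7 Thm. p. 66] -/
theorem natCard_ne_zero_field [Nonempty Δ] : (Nat.card Δ : ↥E) ≠ 0 :=
  Nat.cast_ne_zero.2 Nat.card_pos.ne'

/-! ## §3 The receptacle: the finite quotient `A = Z_E/Δ` and its complex base change -/

/-- (iv) `A = Z_E/Δ` (the tree's `Motives.finiteQuotient` of `actZE`, for ANY admissible cover) is separated over `E`.
[cite: MumfordAV1970, §7 Thm. p. 66] -/
theorem isSeparated_finiteQuotient_baseChange_hom [IsSeparated ((Motives.baseChange ℚ ↥E).obj (R.Nm.obj KN)).hom]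
    (hcovZE : ∀ z : ((Motives.baseChange ℚ ↥E).obj (R.Nm.obj KN)).left, ∃ O : (⟨((Over.forget _).mapAut ((Motives.baseChange ℚ ↥E).obj (R.Nm.obj KN))).comp actZE, fun d => Over.w (actZE d).hom⟩ : ActionOver ((Motives.baseChange ℚ ↥E).obj (R.Nm.obj KN)).hom Δ).StableAffineOpens, z ∈ O.1) :
    IsSeparated (finiteQuotient (⟨((Over.forget _).mapAut ((Motives.baseChange ℚ ↥E).obj (R.Nm.obj KN))).comp actZE, fun d => Over.w (actZE d).hom⟩ : ActionOver ((Motives.baseChange ℚ ↥E).obj (R.Nm.obj KN)).hom Δ)).hom :=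
  isSeparated_finiteQuotient_hom _ hcovZE

/-- (iv) `Z_E ⟶ Z_E/Δ` is a quotient for separated test objects ([SGA1 V Prop. 1.8]; Q5 `isSepQuotient_finiteQuotientMk`).
[cite: SGA1, Exp. V, Prop. 1.8] [cite: MumfordAV1970, §7 Thm. p. 66] -/
theorem isSepQuotient_finiteQuotientMk_baseChange [IsSeparated ((Motives.baseChange ℚ ↥E).obj (R.Nm.obj KN)).hom]
    (hcovZE : ∀ z : ((Motives.baseChange ℚ ↥E).obj (R.Nm.obj KN)).left, ∃ O : (⟨((Over.forget _).mapAut ((Motives.baseChange ℚ ↥E).obj (R.Nm.obj KN))).comp actZE, fun d => Over.w (actZE d).hom⟩ : ActionOver ((Motives.baseChange ℚ ↥E).obj (R.Nm.obj KN)).hom Δ).StableAffineOpens, z ∈ O.1) :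
    IsSepQuotient (fun d => actZE d) (finiteQuotient.mk (⟨((Over.forget _).mapAut ((Motives.baseChange ℚ ↥E).obj (R.Nm.obj KN))).comp actZE, fun d => Over.w (actZE d).hom⟩ : ActionOver ((Motives.baseChange ℚ ↥E).obj (R.Nm.obj KN)).hom Δ) hcovZE) :=
  isSepQuotient_finiteQuotientMk _ hcovZE

/-- **(iv) THE RECEPTACLE, ∃-packaged**: for compatible actions (`hZ : actZ d = (actZE d) ⊗_E ℂ`), with `A := Z_E/Δ` and `mk_E : Z_E ⟶ A`
(for the cover of §1, returned first, together with the cover of `Z`), the base change `A ⊗_E ℂ` is canonically the quotient `Z/Δ` of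
`Z = Z_E ⊗_E ℂ`: there is `i : A ⊗_E ℂ ≅ Z/Δ` with `(mk_E ⊗_E ℂ) ≫ i = mk_ℂ` — base change of a finite quotient of a quasi-projective scheme
along `E ⊂ ℂ` is the quotient of the base change ([SGA1 V Prop. 1.9]; Q5 `isSepQuotient_baseChangeHom_of_isQuasiProjectiveOver` +
`isoFiniteQuotient_of_isSepQuotient_of_cover`; `baseChangeHom (algebraMap E ℂ) = baseChange E ℂ` by `rfl`).  The closer of `stub_Squot` descends
the equivariant closed immersion of D3 into `Z/Δ` and pulls it back along this `i`.
[cite: SGA1, Exp. V, Prop. 1.8 and Prop. 1.9] [cite: MumfordAV1970, §7 Thm. p. 66 and Remark p. 69] [cite: Deligne1971TravauxShimura, (5.11.1)] -/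
theorem exists_receptacle_finiteQuotient [IsSeparated ((Motives.baseChange ℚ ↥E).obj (R.Nm.obj KN)).hom] [IsSeparated ((Motives.baseChange ↥E ℂ).obj ((Motives.baseChange ℚ ↥E).obj (R.Nm.obj KN))).hom]
    (hZ : ∀ d : Δ, actZ d = (Motives.baseChange ↥E ℂ).mapIso (actZE d)) :
    ∃ (hcovZE : ∀ z : ((Motives.baseChange ℚ ↥E).obj (R.Nm.obj KN)).left, ∃ O : (⟨((Over.forget _).mapAut ((Motives.baseChange ℚ ↥E).obj (R.Nm.obj KN))).comp actZE, fun d => Over.w (actZE d).hom⟩ : ActionOver ((Motives.baseChange ℚ ↥E).obj (R.Nm.obj KN)).hom Δ).StableAffineOpens, z ∈ O.1)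
      (hcovZ : ∀ z : ((Motives.baseChange ↥E ℂ).obj ((Motives.baseChange ℚ ↥E).obj (R.Nm.obj KN))).left, ∃ O : (⟨((Over.forget _).mapAut ((Motives.baseChange ↥E ℂ).obj ((Motives.baseChange ℚ ↥E).obj (R.Nm.obj KN)))).comp actZ, fun d => Over.w (actZ d).hom⟩ : ActionOver ((Motives.baseChange ↥E ℂ).obj ((Motives.baseChange ℚ ↥E).obj (R.Nm.obj KN))).hom Δ).StableAffineOpens, z ∈ O.1)
      (i : (Motives.baseChange ↥E ℂ).obj (finiteQuotient (⟨((Over.forget _).mapAut ((Motives.baseChange ℚ ↥E).obj (R.Nm.obj KN))).comp actZE, fun d => Over.w (actZE d).hom⟩ : ActionOver ((Motives.baseChange ℚ ↥E).obj (R.Nm.obj KN)).hom Δ)) ≅ finiteQuotient (⟨((Over.forget _).mapAut ((Motives.baseChange ↥E ℂ).obj ((Motives.baseChange ℚ ↥E).obj (R.Nm.obj KN)))).comp actZ, fun d => Over.w (actZ d).hom⟩ : ActionOver ((Motives.baseChange ↥E ℂ).obj ((Motives.baseChange ℚ ↥E).obj (R.Nm.obj KN))).hom Δ)),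
      (Motives.baseChange ↥E ℂ).map (finiteQuotient.mk (⟨((Over.forget _).mapAut ((Motives.baseChange ℚ ↥E).obj (R.Nm.obj KN))).comp actZE, fun d => Over.w (actZE d).hom⟩ : ActionOver ((Motives.baseChange ℚ ↥E).obj (R.Nm.obj KN)).hom Δ) hcovZE) ≫ i.hom = finiteQuotient.mk (⟨((Over.forget _).mapAut ((Motives.baseChange ↥E ℂ).obj ((Motives.baseChange ℚ ↥E).obj (R.Nm.obj KN)))).comp actZ, fun d => Over.w (actZ d).hom⟩ : ActionOver ((Motives.baseChange ↥E ℂ).obj ((Motives.baseChange ℚ ↥E).obj (R.Nm.obj KN))).hom Δ) hcovZ := by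
  classical
  haveI : Fintype Δ := Fintype.ofFinite Δ
  refine ⟨forall_exists_stableAffineOpen_baseChange R KN E Δ actZE,
    forall_exists_stableAffineOpen_baseChange_baseChange R KN E Δ actZ, ?_⟩
  -- base change of the `E`-quotient along `E ⊂ ℂ` is a quotient of `Z` for separated test objects (Q5)
  have hq := isSepQuotient_baseChangeHom_of_isQuasiProjectiveOver ↥E (algebraMap ↥E ℂ) Δ ((Motives.baseChange ℚ ↥E).obj (R.Nm.obj KN))
    (finiteQuotient (⟨((Over.forget _).mapAut ((Motives.baseChange ℚ ↥E).obj (R.Nm.obj KN))).comp actZE, fun d => Over.w (actZE d).hom⟩ : ActionOver ((Motives.baseChange ℚ ↥E).obj (R.Nm.obj KN)).hom Δ)) (isQuasiProjectiveOver_baseChange R KN E) actZE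
    (finiteQuotient.mk (⟨((Over.forget _).mapAut ((Motives.baseChange ℚ ↥E).obj (R.Nm.obj KN))).comp actZE, fun d => Over.w (actZE d).hom⟩ : ActionOver ((Motives.baseChange ℚ ↥E).obj (R.Nm.obj KN)).hom Δ) (forall_exists_stableAffineOpen_baseChange R KN E Δ actZE))
    (isSeparated_finiteQuotient_baseChange_hom R KN E Δ actZE (forall_exists_stableAffineOpen_baseChange R KN E Δ actZE))
    (isSepQuotient_finiteQuotientMk_baseChange R KN E Δ actZE (forall_exists_stableAffineOpen_baseChange R KN E Δ actZE))
  -- the compatible action on `Z` is the base-changed one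
  have hq' : IsSepQuotient (fun d => actZ d)
      ((Motives.baseChange ↥E ℂ).map
        (finiteQuotient.mk (⟨((Over.forget _).mapAut ((Motives.baseChange ℚ ↥E).obj (R.Nm.obj KN))).comp actZE, fun d => Over.w (actZE d).hom⟩ : ActionOver ((Motives.baseChange ℚ ↥E).obj (R.Nm.obj KN)).hom Δ) (forall_exists_stableAffineOpen_baseChange R KN E Δ actZE))) := by
    simp only [hZ]
    exact hq.2
  -- hence `A ⊗_E ℂ ≅ Z/Δ` under `Z`
  exact isoFiniteQuotient_of_isSepQuotient_of_cover actZ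
    (forall_exists_stableAffineOpen_baseChange_baseChange R KN E Δ actZ) _ hq.1 hq'

/-! ## §4 The instantiation of the closer: actions transported from a `ℚ`-action `ρ₀` (then `hZ` is `rfl`) -/

omit [Finite Δ] in
/-- For `actZE := (bc ℚ E).mapAut ∘ ρ₀` and `actZ := (bc E ℂ).mapAut ∘ actZE` (the integral Hecke action of Deligne's Déf. 3.1 «modèle …
muni de l'action», transported), `(actZ d).hom` is the double base change of `(ρ₀ d).hom` (`Functor.mapAut` is `Functor.mapIso`;
definitional). [cite: Deligne1971TravauxShimura, Déf. 3.1 p. 136] -/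
theorem actZ_hom (ρ₀ : Δ →* Aut (R.Nm.obj KN)) (d : Δ) :
    ((((Motives.baseChange ↥E ℂ).mapAut ((Motives.baseChange ℚ ↥E).obj (R.Nm.obj KN))).comp (((Motives.baseChange ℚ ↥E).mapAut (R.Nm.obj KN)).comp ρ₀)) d).hom = (Motives.baseChange ↥E ℂ).map ((Motives.baseChange ℚ ↥E).map (ρ₀ d).hom) :=
  rfl

omit [Finite Δ] in
/-- `(actZE d).hom = (ρ₀ d).hom ⊗_ℚ E` for `actZE := (bc ℚ E).mapAut ∘ ρ₀` (definitional). [cite: Deligne1971TravauxShimura, Déf. 3.1 p. 136] -/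
theorem actZE_hom (ρ₀ : Δ →* Aut (R.Nm.obj KN)) (d : Δ) :
    ((((Motives.baseChange ℚ ↥E).mapAut (R.Nm.obj KN)).comp ρ₀) d).hom = (Motives.baseChange ℚ ↥E).map (ρ₀ d).hom :=
  rfl

omit [Finite Δ] in
/-- The compatibility `hZ` of `exists_receptacle_finiteQuotient` for the transported actions holds by `rfl`.
[cite: Deligne1971TravauxShimura, Déf. 3.1 p. 136] -/
theorem mapAut_comp_apply_eq_mapIso (ρ₀ : Δ →* Aut (R.Nm.obj KN)) (d : Δ) :
    (((Motives.baseChange ↥E ℂ).mapAut ((Motives.baseChange ℚ ↥E).obj (R.Nm.obj KN))).comp (((Motives.baseChange ℚ ↥E).mapAut (R.Nm.obj KN)).comp ρ₀)) d = (Motives.baseChange ↥E ℂ).mapIso ((((Motives.baseChange ℚ ↥E).mapAut (R.Nm.obj KN)).comp ρ₀) d) :=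
  rfl

/-- **(iv) for the transported Hecke action** — `exists_receptacle_finiteQuotient` at `actZE := (bc ℚ E).mapAut ∘ ρ₀`,
`actZ := (bc E ℂ).mapAut ∘ actZE` (`hZ := fun _ => rfl`). [cite: SGA1, Exp. V, Prop. 1.8 and Prop. 1.9] [cite: MumfordAV1970, §7 Thm. p. 66]
[cite: Deligne1971TravauxShimura, (5.11.1)] -/
theorem exists_receptacle_finiteQuotient_of_aut (ρ₀ : Δ →* Aut (R.Nm.obj KN)) [IsSeparated ((Motives.baseChange ℚ ↥E).obj (R.Nm.obj KN)).hom] [IsSeparated ((Motives.baseChange ↥E ℂ).obj ((Motives.baseChange ℚ ↥E).obj (R.Nm.obj KN))).hom] :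
    ∃ (hcovZE : ∀ z : ((Motives.baseChange ℚ ↥E).obj (R.Nm.obj KN)).left, ∃ O : (⟨((Over.forget _).mapAut ((Motives.baseChange ℚ ↥E).obj (R.Nm.obj KN))).comp (((Motives.baseChange ℚ ↥E).mapAut (R.Nm.obj KN)).comp ρ₀), fun d => Over.w ((((Motives.baseChange ℚ ↥E).mapAut (R.Nm.obj KN)).comp ρ₀) d).hom⟩ : ActionOver ((Motives.baseChange ℚ ↥E).obj (R.Nm.obj KN)).hom Δ).StableAffineOpens, z ∈ O.1)
      (hcovZ : ∀ z : ((Motives.baseChange ↥E ℂ).obj ((Motives.baseChange ℚ ↥E).obj (R.Nm.obj KN))).left, ∃ O : (⟨((Over.forget _).mapAut ((Motives.baseChange ↥E ℂ).obj ((Motives.baseChange ℚ ↥E).obj (R.Nm.obj KN)))).comp (((Motives.baseChange ↥E ℂ).mapAut ((Motives.baseChange ℚ ↥E).obj (R.Nm.obj KN))).comp (((Motives.baseChange ℚ ↥E).mapAut (R.Nm.obj KN)).comp ρ₀)), fun d => Over.w ((((Motives.baseChange ↥E ℂ).mapAut ((Motives.baseChange ℚ ↥E).obj (R.Nm.obj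 KN))).comp (((Motives.baseChange ℚ ↥E).mapAut (R.Nm.obj KN)).comp ρ₀)) d).hom⟩ : ActionOver ((Motives.baseChange ↥E ℂ).obj ((Motives.baseChange ℚ ↥E).obj (R.Nm.obj KN))).hom Δ).StableAffineOpens, z ∈ O.1)
      (i : (Motives.baseChange ↥E ℂ).obj (finiteQuotient (⟨((Over.forget _).mapAut ((Motives.baseChange ℚ ↥E).obj (R.Nm.obj KN))).comp (((Motives.baseChange ℚ ↥E).mapAut (R.Nm.obj KN)).comp ρ₀), fun d => Over.w ((((Motives.baseChange ℚ ↥E).mapAut (R.Nm.obj KN)).comp ρ₀) d).hom⟩ : ActionOver ((Motives.baseChange ℚ ↥E).obj (R.Nm.obj KN)).hom Δ)) ≅ finiteQuotient (⟨((Over.forget _).mapAut ((Motives.baseChange ↥E ℂ).obj ((Motives.baseChange ℚ ↥E).obj (R.Nm.obj KN)))).comp (((Motives.baseChange ↥E ℂ).mapAut ((Motives.baseChange ℚ ↥E).obj (R.Nm.obj KN))).comp (((Motives.baseChange ℚ ↥E).mapAut (R.Nm.obj KN)).comp ρ₀)), fun d => Over.w ((((Motives.baseChange ↥E ℂ).mapAut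 ((Motives.baseChange ℚ ↥E).obj (R.Nm.obj KN))).comp (((Motives.baseChange ℚ ↥E).mapAut (R.Nm.obj KN)).comp ρ₀)) d).hom⟩ : ActionOver ((Motives.baseChange ↥E ℂ).obj ((Motives.baseChange ℚ ↥E).obj (R.Nm.obj KN))).hom Δ)),
      (Motives.baseChange ↥E ℂ).map (finiteQuotient.mk (⟨((Over.forget _).mapAut ((Motives.baseChange ℚ ↥E).obj (R.Nm.obj KN))).comp (((Motives.baseChange ℚ ↥E).mapAut (R.Nm.obj KN)).comp ρ₀), fun d => Over.w ((((Motives.baseChange ℚ ↥E).mapAut (R.Nm.obj KN)).comp ρ₀) d).hom⟩ : ActionOver ((Motives.baseChange ℚ ↥E).obj (R.Nm.obj KN)).hom Δ) hcovZE) ≫ i.hom = finiteQuotient.mk (⟨((Over.forget _).mapAut ((Motives.baseChange ↥E ℂ).obj ((Motives.baseChange ℚ ↥E).obj (R.Nm.obj KN)))).comp (((Motives.baseChange ↥E ℂ).mapAut ((Motives.baseChange ℚ ↥E).obj (R.Nm.obj KN))).comp (((Motives.baseChange ℚ ↥E).mapAut (R.Nm.obj KN)).comp ρ₀)), fun d =>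 Over.w ((((Motives.baseChange ↥E ℂ).mapAut ((Motives.baseChange ℚ ↥E).obj (R.Nm.obj KN))).comp (((Motives.baseChange ℚ ↥E).mapAut (R.Nm.obj KN)).comp ρ₀)) d).hom⟩ : ActionOver ((Motives.baseChange ↥E ℂ).obj ((Motives.baseChange ℚ ↥E).obj (R.Nm.obj KN))).hom Δ) hcovZ :=
  exists_receptacle_finiteQuotient R KN E Δ (((Motives.baseChange ℚ ↥E).mapAut (R.Nm.obj KN)).comp ρ₀) (((Motives.baseChange ↥E ℂ).mapAut ((Motives.baseChange ℚ ↥E).obj (R.Nm.obj KN))).comp (((Motives.baseChange ℚ ↥E).mapAut (R.Nm.obj KN)).comp ρ₀)) (fun _ => rfl)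

end SiegelRationalModel

end Literature.AlgebraicGeometry.ModuliOfAbelianVarieties

end
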